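import Summits.ABC.ABC.Theorems.IsogenyGlueCongruencePolyHeightOfBoundedPrimesHallSplit
import Summits.ABC.ABC.Theorems.PolyHeightOfBoundedPrimes.Negative.SplitBookkeeping
import Summits.ABC.ABC.Theorems.IsogenyGlueCongruencePolyHeightOfBoundedPrimesStubPolyHallDeltaOfPolyHall

/-!
# `PolyHeightOfBoundedPrimes` (stmt-ABC-16006, crux B′) — line `Sketch` (card `archimedean-hall-split`):
the transfer target is EXACTLY `H`, and the crux follows from the finite half plus weak Hall

Two corollaries over landed files of the line (lead c1, cycle 1):

* `stub_polyHeight_iff_split` (registered exactness stub; alias `polyHeight_iff_split`) — `H ↔ PolySzpiroΔ ∧ PolyHallΔ` (`→`: the disprover's `Negative.split_of_polyHeight`,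
  p122124; `←`: `HallSplit.polyHeight_of_split`, p122489). The split isolates two difficulties of `H` without
  adding strength; the landed floors of the halves (`σ > 6`, `σ' ≥ 3/2`) therefore bind every split proof.
* `of_finiteHalf_of_weakHall` — `PolySzpiroΔ → WeakHall → PolyHeightOfBoundedPrimes`: the crux follows from the
  discriminant-form polynomial Szpiro conjecture for semistable curves together with the free-exponent Hall
  inequality `c·|x|^θ ≤ |x³ − y²|` (`x³ ≠ y²`), through the landed engine interface of the Hall half
  (`HallSplit.stub_polyHallDelta_of_polyHall`, p122623) and the registered transfer stub (p122489).

CONDITIONAL bridges (both antecedents are open conjectures in print); nothing here closes the item.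
-/

noncomputable section

-- single-conjunct summit ABC: the duplicate ABC.ABC is mandated (CONVENTIONS §2)
set_option linter.dupNamespace false

namespace Summit.ABC.ABC.Theorems.PolyHeightOfBoundedPrimes.HallSplit

open WeierstrassCurve
open Summit.ABC.ABC.Theses.IsogenyGlueCongruence

/-- **The transfer target is exactly `H`: `H ↔ PolySzpiroΔ ∧ PolyHallΔ`** (`→` is the disprover's landed
`Negative.split_of_polyHeight`, p122124, from `1 ≤ N_W ≤ |Δ_W|`; `←` is `polyHeight_of_split`). The line
isolates two difficulties of `H` without adding strength. [folklore] -/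
theorem stub_polyHeight_iff_split :
    (∃ σ C : ℝ, ∀ (W : WeierstrassCurve ℚ) [W.IsElliptic] [W.IsGloballyMinimal]
      [NeZero (W.conductorNorm ℤ)], W.IsSemistable ℤ →
        ((max |W.Δ| (|W.c₄| ^ 3) : ℚ) : ℝ) ≤ C * (W.conductorNorm ℤ : ℝ) ^ σ) ↔
    ((∃ σ C : ℝ, ∀ (W : WeierstrassCurve ℚ) [W.IsElliptic] [W.IsGloballyMinimal]
      [NeZero (W.conductorNorm ℤ)], W.IsSemistable ℤ →
        ((|W.Δ| : ℚ) : ℝ) ≤ C * (W.conductorNorm ℤ : ℝ) ^ σ) ∧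
    (∃ σ C : ℝ, 0 ≤ σ ∧ ∀ (W : WeierstrassCurve ℚ) [W.IsElliptic] [W.IsGloballyMinimal]
      [NeZero (W.conductorNorm ℤ)], W.IsSemistable ℤ →
        ((|W.c₄| ^ 3 : ℚ) : ℝ) ≤ C * ((|W.Δ| : ℚ) : ℝ) ^ σ)) :=
  ⟨Summit.ABC.ABC.Theorems.PolyHeightOfBoundedPrimes.Negative.split_of_polyHeight,
    fun h ↦ polyHeight_of_split h.1 h.2⟩

/-- `H ↔ PolySzpiroΔ ∧ PolyHallΔ` (alias of the registered exactness stub `stub_polyHeight_iff_split`). [folklore] -/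
theorem polyHeight_iff_split :
    (∃ σ C : ℝ, ∀ (W : WeierstrassCurve ℚ) [W.IsElliptic] [W.IsGloballyMinimal]
      [NeZero (W.conductorNorm ℤ)], W.IsSemistable ℤ →
        ((max |W.Δ| (|W.c₄| ^ 3) : ℚ) : ℝ) ≤ C * (W.conductorNorm ℤ : ℝ) ^ σ) ↔
    ((∃ σ C : ℝ, ∀ (W : WeierstrassCurve ℚ) [W.IsElliptic] [W.IsGloballyMinimal]
      [NeZero (W.conductorNorm ℤ)], W.IsSemistable ℤ →
        ((|W.Δ| : ℚ) : ℝ) ≤ C * (W.conductorNorm ℤ : ℝ) ^ σ) ∧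
    (∃ σ C : ℝ, 0 ≤ σ ∧ ∀ (W : WeierstrassCurve ℚ) [W.IsElliptic] [W.IsGloballyMinimal]
      [NeZero (W.conductorNorm ℤ)], W.IsSemistable ℤ →
        ((|W.c₄| ^ 3 : ℚ) : ℝ) ≤ C * ((|W.Δ| : ℚ) : ℝ) ^ σ)) :=
  stub_polyHeight_iff_split

/-- **`PolySzpiroΔ ∧ WeakHall ⟹ B′`**: the crux follows from the discriminant-form polynomial Szpiro
conjecture for semistable curves together with the free-exponent Hall inequality
`c·|x|^θ ≤ |x³ − y²|` (`x³ ≠ y²`, some `θ, c > 0`), through the landed engine interface of the Hall half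
(`polyHallDelta_of_polyHall`, p122623: `σ' = 3/θ`). [folklore] -/
theorem of_finiteHalf_of_weakHall
    (hΔ : ∃ σ C : ℝ, ∀ (W : WeierstrassCurve ℚ) [W.IsElliptic] [W.IsGloballyMinimal]
      [NeZero (W.conductorNorm ℤ)], W.IsSemistable ℤ →
        ((|W.Δ| : ℚ) : ℝ) ≤ C * (W.conductorNorm ℤ : ℝ) ^ σ)
    (hHall : ∃ θ c : ℝ, 0 < θ ∧ 0 < c ∧ ∀ x y : ℤ, x ^ 3 ≠ y ^ 2 →
      c * |(x : ℝ)| ^ θ ≤ |((x : ℝ) ^ 3 - (y : ℝ) ^ 2)|) :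
    PolyHeightOfBoundedPrimes :=
  stub_polyHeightOfBoundedPrimes_of_split hΔ (stub_polyHallDelta_of_polyHall hHall)

end Summit.ABC.ABC.Theorems.PolyHeightOfBoundedPrimes.HallSplit

end
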